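import Mathlib
import Summits.NavierStokesRegularity.NavierStokesRegularity.Theorems.SubOnsagerCeilingKPRelabelCornersQuarter
import Summits.NavierStokesRegularity.NavierStokesRegularity.Theorems.SubOnsagerCeilingDyadicTailCeilingQuarterRatio
import Summits.NavierStokesRegularity.NavierStokesRegularity.Theorems.SubOnsagerCeilingKPBarrierCurrency
import HarnessLib

/-!
# STUB 1 of crux 27057 on its proved sub-class, in the stub's OWN currency and on its WHOLE ratio range
# (helper file for the crux `SubOnsagerCeiling.ForwardTailCeilingKP`, stmt-NavierStokesRegularity-27057, `--supports`;
# hand leafhand-ns-subonsagerceiling-4 gen 22)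

The registered stub `stub_primaryGradedLargeRatio` of the LEAD skeleton `Cruxes/ForwardTailCeilingKP/Lines/kp_shell_barrier.lean`
reads `∀ R ≥ 1, ∀ ε₀ ∈ (1/4, 1], ∀ α, PrimaryGradedAt R ε₀ α`.  After the chain descent of hands 4-g20 / 4-g21 (KP chain `θ = 101/200`,
`D = 100` at every `b ∈ [5/4, 2]`) and the glue / transfers of this hand (`SubOnsagerCeilingGapArchitectures5`,
`SubOnsagerCeilingKPRelabelCornersQuarter`, `SubOnsagerCeilingDyadicTailCeilingQuarterRatio`), the stub is PROVED — in its own currency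
(the body of `PrimaryGradedAt R ε₀ α` verbatim, via the currency lemma `kpPrimaryGraded_of_shellBarrierAt`: trivial grading `lev ≡ 0`,
exponent `min θ 1`) and on its WHOLE ratio range `ε₀ ∈ [1/4, 1] ⊇ (1/4, 1]` — on the following sub-class `𝒞₁` of tables, at ANY
placement `σ` of the components:

* the scaled Katz–Pavlović chain on any component (`β = c·dyadicTable ∘ σ`, `c > 0`);
* uniform KP permutation networks (`β = kpPermTable τ c ∘ σ`, `c` constant on `τ`-orbits);
* uniform KP fan networks (`β = kpFanTable w ∘ σ`, any `w`);
* the uniform re-entry pair (`β = kpTwoCycleTable c c ∘ σ`, `c > 0`).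

`stubOne_on_classOne` states exactly this with one disjunctive class hypothesis, so that a successor skeleton can cite ONE name for the
four architecture corners at every `ε₀ ∈ [1/4, 1]`.  What is NOT covered (the stub's open remainder, unchanged): every other KP network
proper of `E₂(R)` — non-uniform cycles outside the certified 2-cycle window, chains carrying in-shell pumps / drains beyond the
side-branch classes (`b ≥ 1.78`), pump ladders (which embed the chain at ratios `(1+ε₀)^{1/2}`, `(1+ε₀)^{1/4}` below `5/4`), reach
pipelines, differential in-shell triads.  HONEST FRAMING: bookkeeping about Tao-type MODEL lattice ODEs (route SubOnsagerCeiling, rung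
TL-M2Break); no stub, crux or summit is proved and nothing here bears on Navier–Stokes regularity.
[cite: Tao2016AveragedNS, §4 (4.2)–(4.3), (4.13)] [cite: BarbatoMorandinRomito2011, §3.2]
-/

noncomputable section

-- the sub-problem namespace `NavierStokesRegularity.NavierStokesRegularity` is the tree's layout (D-0017)
set_option linter.dupNamespace false

namespace Summit.NavierStokesRegularity.NavierStokesRegularity.Theorems

open Literature.Analysis.FluidPDE.TaoCascade
open Summit.NavierStokesRegularity.NavierStokesRegularity.Theorems.SubOnsagerCeiling

/-- **The class-`𝒞₁` shell barrier at every `ε₀ ∈ [1/4, 1]`**: a table `β` which is, up to a placement `σ` of the components, a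
scaled KP chain, a uniform KP permutation network, a uniform fan network or the uniform re-entry pair obeys `ShellBarrierAt R ε₀ β` for
every spread `R` and every `ε₀ ∈ [1/4, 1]` (glue of `kpRelabel_chain_shellBarrierAt_quarter`, `kpRelabel_perm_shellBarrierAt_quarter`,
`kpRelabel_fan_shellBarrierAt_quarter`, `kpRelabel_twoCycle_shellBarrierAt_quarter`). [cite: BarbatoMorandinRomito2011, §3.2] -/
theorem classOne_shellBarrierAt_quarter {β : Fin 4 → Fin 4 → Fin 4 → ℤ × ℤ × ℤ → ℝ} (σ : Equiv.Perm (Fin 4))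
    (hβ : (∃ c : ℝ, 0 < c ∧ ∀ i₁ i₂ i₃ μ, β i₁ i₂ i₃ μ = c * dyadicTable (σ i₁) (σ i₂) (σ i₃) μ) ∨
      (∃ (τ : Equiv.Perm (Fin 4)) (c : Fin 4 → ℝ), (∀ a, c (τ a) = c a) ∧
        ∀ i₁ i₂ i₃ μ, β i₁ i₂ i₃ μ = kpPermTable τ c (σ i₁) (σ i₂) (σ i₃) μ) ∨
      (∃ w : Fin 4 → ℝ, ∀ i₁ i₂ i₃ μ, β i₁ i₂ i₃ μ = kpFanTable w (σ i₁) (σ i₂) (σ i₃) μ) ∨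
      (∃ c : ℝ, 0 < c ∧ ∀ i₁ i₂ i₃ μ, β i₁ i₂ i₃ μ = kpTwoCycleTable c c (σ i₁) (σ i₂) (σ i₃) μ)) :
    ∀ R : ℝ, ∀ ε₀ : ℝ, (1 : ℝ) / 4 ≤ ε₀ → ε₀ ≤ 1 → ShellBarrierAt R ε₀ β := by
  intro R ε₀ h1 h2
  rcases hβ with ⟨c, hc, h⟩ | ⟨τ, c, hcyc, h⟩ | ⟨w, h⟩ | ⟨c, hc, h⟩
  · exact kpRelabel_chain_shellBarrierAt_quarter σ hc h R ε₀ h1 h2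
  · exact kpRelabel_perm_shellBarrierAt_quarter σ hcyc h R ε₀ h1 h2
  · exact kpRelabel_fan_shellBarrierAt_quarter σ w h R ε₀ h1 h2
  · exact kpRelabel_twoCycle_shellBarrierAt_quarter σ hc h R ε₀ h1 h2

/-- **STUB 1 (`stub_primaryGradedLargeRatio`) on the class `𝒞₁`, in its own currency, on its whole ratio range.**  For every spread
`R`, every `ε₀ ∈ [1/4, 1]` and every table `β` of the class `𝒞₁` (scaled KP chain / uniform permutation network / uniform fan network /
uniform re-entry pair, at any placement `σ`): the body of `PrimaryGradedAt R ε₀ β` verbatim — under the table-class, orthant and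
diagonal-feed binders there is a grading `lev` (here `lev ≡ 0`, `L = 0`) with the structural clauses and a ν-uniform weighted shell
barrier `θ ∈ (1/2, 1]` of the level-0 modes along every honest non-negative viscous solution from every one-shell datum.
Composition of `classOne_shellBarrierAt_quarter` with the currency lemma `kpPrimaryGraded_of_shellBarrierAt`. MODEL lattice statement;
the stub itself (every table) stays OPEN. [cite: Tao2016AveragedNS, §4 (4.13)] [cite: BarbatoMorandinRomito2011, §3.2] -/
theorem stubOne_on_classOne {β : Fin 4 → Fin 4 → Fin 4 → ℤ × ℤ × ℤ → ℝ} (σ : Equiv.Perm (Fin 4))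
    (hβ : (∃ c : ℝ, 0 < c ∧ ∀ i₁ i₂ i₃ μ, β i₁ i₂ i₃ μ = c * dyadicTable (σ i₁) (σ i₂) (σ i₃) μ) ∨
      (∃ (τ : Equiv.Perm (Fin 4)) (c : Fin 4 → ℝ), (∀ a, c (τ a) = c a) ∧
        ∀ i₁ i₂ i₃ μ, β i₁ i₂ i₃ μ = kpPermTable τ c (σ i₁) (σ i₂) (σ i₃) μ) ∨
      (∃ w : Fin 4 → ℝ, ∀ i₁ i₂ i₃ μ, β i₁ i₂ i₃ μ = kpFanTable w (σ i₁) (σ i₂) (σ i₃) μ) ∨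
      (∃ c : ℝ, 0 < c ∧ ∀ i₁ i₂ i₃ μ, β i₁ i₂ i₃ μ = kpTwoCycleTable c c (σ i₁) (σ i₂) (σ i₃) μ))
    (R ε₀ : ℝ) (hε : (1 : ℝ) / 4 ≤ ε₀) (hε1 : ε₀ ≤ 1) :
    Literature.Analysis.FluidPDE.TaoCascade.InTableClass R β →
      (∀ (Y : Fin 4 → ℤ → ℝ → ℝ) (τ : ℝ), (∀ (j : Fin 4) (k : ℤ), 1 ≤ k → 0 ≤ Y j k τ) → ∀ δ : ℝ, 0 < δ →
        ∀ (i : Fin 4) (n : ℤ), 1 ≤ n → Y i n τ = 0 → 0 ≤ Literature.Analysis.FluidPDE.TaoCascade.quadTerm δ β Y i n τ) →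
      (∀ a b i : Fin 4, a ≠ b → β a b i (0, 0, 1) = 0) →
      ∃ (lev : Fin 4 → ℕ) (L : ℕ), (∀ a, lev a ≤ L) ∧
        (∀ a, lev a ≠ 0 → (∃ e, β a a e (0, 0, 1) ≠ 0) →
          (∀ j, β j j a (0, 0, 1) ≠ 0 → lev j < lev a ∧ (lev j = 0 ∨ ∃ e', β j j e' (0, 0, 1) ≠ 0)) ∧
          (∀ i₁ i₂, i₁ ≠ a → i₂ ≠ a → β i₁ i₂ a (0, 0, 0) ≠ 0 →
            (lev i₁ < lev a ∧ (lev i₁ = 0 ∨ ∃ e', β i₁ i₁ e' (0, 0, 1) ≠ 0)) ∧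
            (lev i₂ < lev a ∧ (lev i₂ = 0 ∨ ∃ e', β i₂ i₂ e' (0, 0, 1) ≠ 0))) ∧
          (∃ e, β a a e (0, 0, 1) ≠ 0 ∧
            (∀ j, β e e j (0, 0, 1) ≠ 0 → lev j < lev a ∧ (lev j = 0 ∨ ∃ e', β j j e' (0, 0, 1) ≠ 0)) ∧
            (∀ j, j ≠ e → β e e j (0, 0, 0) ≠ 0 →
              lev j < lev a ∧ (lev j = 0 ∨ ∃ e', β j j e' (0, 0, 1) ≠ 0)))) ∧
        ∃ θ : ℝ, 1 / 2 < θ ∧ θ ≤ 1 ∧ ∃ D : ℝ, 0 ≤ D ∧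
          ∀ ν : ℝ, 0 < ν → ∀ (X₀ : Fin 4 → ℝ) (s : ℝ), 0 < s → ∀ X : Fin 4 → ℤ → ℝ → ℝ,
          (∀ (i : Fin 4) (k : ℤ), X i k 0 = if k = 0 then X₀ i else 0) →
          (∀ (i : Fin 4) (k : ℤ), k < 0 → ∀ t : ℝ, X i k t = 0) →
          (∃ M : ℝ, ∀ (t : ℝ) (i : Fin 4) (k : ℤ), (1 + (1 + ε₀) ^ ((10 : ℝ) * k)) * |X i k t| ≤ M) →
          (∀ (i : Fin 4) (k : ℤ), Continuous (X i k)) →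
          (∀ (i : Fin 4) (k : ℤ), ∀ t ∈ Set.Icc (0 : ℝ) s, HasDerivWithinAt (X i k)
            (Literature.Analysis.FluidPDE.TaoCascade.quadTerm ε₀ β X i k t - ν * (1 + ε₀) ^ ((2 : ℝ) * k) * X i k t)
            (Set.Icc (0 : ℝ) s) t) →
          (∀ t ∈ Set.Icc (0 : ℝ) s, ∀ (i : Fin 4) (k : ℤ), 1 ≤ k → 0 ≤ X i k t) →
          ∀ t ∈ Set.Icc (0 : ℝ) s, ∀ i, lev i = 0 → ∀ k : ℕ,
            (1 + ε₀) ^ (2 * θ * (k : ℝ)) * ((1 / 2 : ℝ) * X i (k : ℤ) t ^ 2) ≤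
              D * (∑ j : Fin 4, (1 / 2 : ℝ) * X₀ j ^ 2) :=
  kpPrimaryGraded_of_shellBarrierAt (by linarith) (classOne_shellBarrierAt_quarter σ hβ R ε₀ hε hε1)

/-- **The same corner in the CRUX's per-table currency**: for `β ∈ 𝒞₁` (any placement) and every `ε₀ ∈ [1/4, 1]`, the tail ceiling
`CeilingAt R ε₀ β` (all four components, `S = univ` admissible in `ForwardTailCeilingKP`), by the geometric series
`subOnsagerCeiling_ceilingAt_of_shellBarrierAt`. [cite: BarbatoMorandinRomito2011, §3.2] -/
theorem classOne_ceilingAt_quarter {β : Fin 4 → Fin 4 → Fin 4 → ℤ × ℤ × ℤ → ℝ} (σ : Equiv.Perm (Fin 4))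
    (hβ : (∃ c : ℝ, 0 < c ∧ ∀ i₁ i₂ i₃ μ, β i₁ i₂ i₃ μ = c * dyadicTable (σ i₁) (σ i₂) (σ i₃) μ) ∨
      (∃ (τ : Equiv.Perm (Fin 4)) (c : Fin 4 → ℝ), (∀ a, c (τ a) = c a) ∧
        ∀ i₁ i₂ i₃ μ, β i₁ i₂ i₃ μ = kpPermTable τ c (σ i₁) (σ i₂) (σ i₃) μ) ∨
      (∃ w : Fin 4 → ℝ, ∀ i₁ i₂ i₃ μ, β i₁ i₂ i₃ μ = kpFanTable w (σ i₁) (σ i₂) (σ i₃) μ) ∨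
      (∃ c : ℝ, 0 < c ∧ ∀ i₁ i₂ i₃ μ, β i₁ i₂ i₃ μ = kpTwoCycleTable c c (σ i₁) (σ i₂) (σ i₃) μ)) :
    ∀ R : ℝ, ∀ ε₀ : ℝ, (1 : ℝ) / 4 ≤ ε₀ → ε₀ ≤ 1 → CeilingAt R ε₀ β :=
  fun R ε₀ h1 h2 =>
    subOnsagerCeiling_ceilingAt_of_shellBarrierAt (by linarith) (classOne_shellBarrierAt_quarter σ hβ R ε₀ h1 h2)

end Summit.NavierStokesRegularity.NavierStokesRegularity.Theorems

end
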